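import Summits.CriticalPhenomena.PercolationContinuityZ3.Theorems.Transplant.KNCellsProcessO
import Summits.CriticalPhenomena.PercolationContinuityZ3.Theorems.Transplant.KNCellsProcess
import Literature.Probability.Percolation.KozmaNitzanSteps
import Summits.CriticalPhenomena.PercolationContinuityZ3.Theorems.Transplant.KNCellsSchemeO
import Summits.CriticalPhenomena.PercolationContinuityZ3.Theorems.Transplant.KNCellsStepsDefs
import Literature.Probability.Percolation.OrientedHistorySiteRenormalizationRun
import HarnessLib

/-!
# N2 (frames-only node `SamePDropOfSkeletonFrm₁`, OPEN) — ORIENTED MACRO LAYER (WAVE 0 (c1), (R-18) `q ≡ true`): the oriented twin of N1's `KNCellsStepsDefs`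

builds on p205010 (kernel theorem, internal audit signed; external expert review pending) — nothing in this file uses p205010; NOTHING is claimed about the
open node `SamePDropOfSkeletonFrm₁` (`SamePDropOfSkeletonNeg₁` is CLOSED in the tree and untouched by this file).
Status sentence (coordinator 2026-08-20T04:30Z): "θ(p_c) = 0 on ℤ^d, all d ≥ 2 — kernel-verified (Lean 4/Mathlib, standard axioms); internal adversarial
audit SIGNED 2026-08-20 04:29Z; external expert review pending."
Lane `prim-bschramm-*`, seat `prim-bschramm-stmt` (gen 19); helper file (`--supports stmt-CriticalPhenomena-4575 --as helper`); N2-SCOPE §20, (R-18)/(R-19).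
PORT RULES (HOME/prim-bschramm-stmt-g19/lean/port_orient.py): the history-site API is replaced by its ORIENTED twin at the fixed quadrant `qNE := fun _ => true`
(`HState.choice ↦ HState.ochoice qNE`, `mstOf ↦ omstOf qNE`, `mst/stN ↦ omst/ostN qNE`, `occFinal ↦ ooccFinal qNE`, `Lawful ↦ OLawful qNE`, onward directions
`onward ↦ onwardO` = the POSITIVE ones, (N2-e)); every declaration whose text changes thereby — directly or through a changed declaration — is re-declared with the
suffix `O` (same namespace); unchanged declarations of the N1 file are NOT repeated (the N1 module is imported). Docstrings/citations are N1's.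
N1 HEADER (kept for the reader):
* §1 `FaceData`, `StepsGeom` (faces inside stubs, stubs inside the corridor, the corridor inside `Q_v ∪ E_{v,x}`), `CellGeom.bigD`;
* §2 `Wfull`, `Reach`, `Aface`, `Fp`, `Bev`, `Gch` (`G_j`), `badA` (bad at a fixed departure anchor), `Dev`; static inclusions;
* §3 determination / measurability; consequences of `Valid`; the almost-sure facts under `μ`;
* §4 **`pinW_Wfull_eq_Wt`** — `μ` pinned on the pairs of level `j` along a lattice pattern extending `ω|_{E_i}` is the weighting of (30).
[cite: KozmaNitzan2024, §4 pp. 29–31 (Steps II–IV, (36)) — the ℤ^d model] [cite: GrimmettPercolation1999, §7.2]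
-/
noncomputable section

open MeasureTheory ProbabilityTheory
open scoped ENNReal Classical

namespace Summit.CriticalPhenomena.PercolationContinuityZ3.Theorems

namespace Transplant

namespace KNCells

open Literature.Probability.Percolation Literature.Probability.LatticeModels SimpleGraph GadgetSystem ProbeHistory HSiteScheme Contour

variable {V : Type*} [DecidableEq V]

/-! ## §1 Faces, the full corridor, the subbox of Step III -/

/-! ## §2 The weighting `μ` and the events of Step IV, at a fixed departure anchor -/

namespace KSchA

variable {A : Type*} (G : SimpleGraph V) [G.LocallyFinite] (S : KSchA V A) (FD : FaceData V A)

/-- **`B_j`** `= {P(root ↔ F^{j+1} | ω|_{E_i ∪ E_{w,v} ∪ H^j}) ≤ 1 - δ₂}`, the conditional probability being that of (30) at level `j` for the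
observation `ω`, at the fixed departure anchor `a'`. [cite: KozmaNitzan2024, §4 p. 30 (B_j)] -/
def BevO (h : ProbeHistory V) (e : Site 2 × MDir) (a a' : A) (du : MDir) (j : ℕ) (δ₂ : ℝ) : Set (BondConfig V) :=
  {ω | (prodBernoulli (S.Wt G h e a a' du j (obs ω (S.envO G h e a)))).real
      (⋃ b ∈ FD.Face a' (tgt e) du (j + 1), openConn S.Γ.root b) ≤ 1 - δ₂}

/-- `G_j = ⋂_{i<j} (A'_i ∩ B_i)`. [cite: KozmaNitzan2024, §4 p. 31 ((36))] -/
def GchO (h : ProbeHistory V) (e : Site 2 × MDir) (a a' : A) (du : MDir) (δ₂ : ℝ) : ℕ → Set (BondConfig V)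
  | 0 => Set.univ
  | j + 1 => S.Aface G FD h e a a' du j ∩ (S.BevO G FD h e a a' du j δ₂ ∩ GchO h e a a' du δ₂ j)

/-- **A bad direction at the fixed departure anchor `a'`**: the connection is good at no level. [cite: KozmaNitzan2024, §4 p. 27 (j_x), p. 31] -/
def badAO (h : ProbeHistory V) (e : Site 2 × MDir) (a a' : A) (du : MDir) : Set (BondConfig V) :=
  {ω | ∀ j < S.Γ.K, ¬S.cond G h e a a' du j (obs ω (S.envO G h e a))}

/-- **The departure anchor chosen by the configuration is `a'`.** [folklore] -/
def DevO (h : ProbeHistory V) (e : Site 2 × MDir) (a a' : A) : Set (BondConfig V) :=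
  {ω | S.depA G h e a (obs ω (S.envO G h e a)) = a'}

variable {G S FD}

section Geometry

variable (hSt : StepsGeom S.Γ FD)
include hSt

end Geometry

/-! ## §3 Determination, measurability, consequences of validity, almost-sure facts -/

/-- `B_j` is determined by the conditioned edges of level `j`. [folklore] -/
theorem determinedBy_BevO (h : ProbeHistory V) (e : Site 2 × MDir) (a a' : A) (du : MDir) (j : ℕ) (δ₂ : ℝ) :
    DeterminedBy (S.BevO G FD h e a a' du j δ₂) (↑(S.Fj G h e a a' du j) : Set (Sym2 V)) := by
  rw [determinedBy_iff]
  intro ω ω' hωω'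
  have key : S.pat G h e a a' du j (obs ω (S.envO G h e a)) = S.pat G h e a a' du j (obs ω' (S.envO G h e a)) := by
    refine S.pat_congr h e a a' du j fun x hx => ?_
    have hxF : x ∈ S.Fj G h e a a' du j := (Finset.mem_sdiff.1 hx).1
    simp only [mem_obs_iff]
    refine and_congr_right fun _ => ⟨fun h1 => ?_, fun h1 => ?_⟩
    · exact ((Set.ext_iff.1 hωω' x).1 ⟨h1, Finset.mem_coe.2 hxF⟩).1
    · exact ((Set.ext_iff.1 hωω' x).2 ⟨h1, Finset.mem_coe.2 hxF⟩).1
  simp only [BevO, Set.mem_setOf_eq, Wt, key]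

/-- A bad direction (fixed departure anchor) is determined by the fresh conditioned edges of level `K - 1`. [folklore] -/
theorem determinedBy_badAO (h : ProbeHistory V) (e : Site 2 × MDir) (a a' : A) (du : MDir) :
    DeterminedBy (S.badAO G h e a a' du) (↑(S.Fj G h e a a' du (S.Γ.K - 1) \ S.F G h) : Set (Sym2 V)) := by
  rw [determinedBy_iff]
  intro ω ω' hωω'
  simp only [badAO, Set.mem_setOf_eq]
  refine forall₂_congr fun j hj => not_congr (S.cond_congr h e a a' du j fun x hx => ?_)
  have hx' : x ∈ S.Fj G h e a a' du (S.Γ.K - 1) \ S.F G h :=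
    Finset.mem_sdiff.2 ⟨S.Fj_mono h e a a' du (by omega) (Finset.mem_sdiff.1 hx).1, (Finset.mem_sdiff.1 hx).2⟩
  simp only [mem_obs_iff]
  refine and_congr_right fun _ => ⟨fun h1 => ?_, fun h1 => ?_⟩
  · exact ((Set.ext_iff.1 hωω' x).1 ⟨h1, Finset.mem_coe.2 hx'⟩).1
  · exact ((Set.ext_iff.1 hωω' x).2 ⟨h1, Finset.mem_coe.2 hx'⟩).1

/-- The chosen-anchor event is determined by the fresh edges of `E_i ∪ E_{w,v}`. [folklore] -/
theorem determinedBy_DevO (h : ProbeHistory V) (e : Site 2 × MDir) (a a' : A) :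
    DeterminedBy (S.DevO G h e a a') (↑(S.baseF G h e a \ S.F G h) : Set (Sym2 V)) := by
  rw [determinedBy_iff]
  intro ω ω' hωω'
  simp only [DevO, Set.mem_setOf_eq]
  rw [S.depA_congr h e a (o := obs ω (S.envO G h e a)) (o' := obs ω' (S.envO G h e a)) fun x hx => ?_]
  simp only [mem_obs_iff]
  refine and_congr_right fun _ => ⟨fun h1 => ?_, fun h1 => ?_⟩
  · exact ((Set.ext_iff.1 hωω' x).1 ⟨h1, Finset.mem_coe.2 hx⟩).1
  · exact ((Set.ext_iff.1 hωω' x).2 ⟨h1, Finset.mem_coe.2 hx⟩).1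

/-- `G_j` is determined by the pairs of level `j`. [folklore] -/
theorem determinedBy_GchO (h : ProbeHistory V) (e : Site 2 × MDir) (a a' : A) (du : MDir) (δ₂ : ℝ) :
    ∀ j, DeterminedBy (S.GchO G FD h e a a' du δ₂ j) (↑(S.Fp G h e a a' du j) : Set (Sym2 V))
  | 0 => determinedBy_univ _
  | j + 1 => by
    have hmono : (↑(S.Fp G h e a a' du j) : Set (Sym2 V)) ⊆ ↑(S.Fp G h e a a' du (j + 1)) :=
      Finset.coe_subset.2 (Fp_mono h e a a' du (Nat.le_succ j))
    refine (determinedBy_Aface h e a a' du j).inter (DeterminedBy.inter ?_ ((determinedBy_GchO h e a a' du δ₂ j).mono hmono))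
    exact (determinedBy_BevO h e a a' du j δ₂).mono ((Finset.coe_subset.2 (Fj_subset_Fp h e a a' du j)).trans hmono)

section Setting

variable {h : ProbeHistory V} {e : Site 2 × MDir} (hV : S.ValidO G h e) {a a' : A} (ha' : a' ∈ S.Γ.anchSet a (tgt e)) {du : MDir}
  (hdu : du ∈ S.onwardO G h (tgt e)) (hSt : StepsGeom S.Γ FD)
include hV

/-- The explored edges are pairs of every level. [folklore] -/
theorem ValidO.coe_F_subset_Fp (j : ℕ) : (((↑(S.F G h) : Set (Sym2 V)) ⊆ ↑(S.Fp G h e a a' du j)) : Prop) :=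
  Finset.coe_subset.2 ((S.F_subset_Fj hV.F_eq e a a' du j).trans (Fj_subset_Fp h e a a' du j))

/-- The explored edges are edges of `G`. [folklore] -/
theorem ValidO.mem_edgeSet_of_mem_F {x : Sym2 V} (hx : x ∈ S.F G h) : ((x ∈ G.edgeSet) : Prop) := by
  rw [hV.F_eq, mem_edgesIn_iff] at hx
  exact hx.1

include ha' hSt in
/-- The explored edges lie inside `E_i ∪ E_{w,v} ∪ E_{v,x}`. [folklore] -/
theorem ValidO.coe_F_subset_wireSet : (((↑(S.F G h) : Set (Sym2 V)) ⊆ wireSet (↑(S.Sx G h e a a' du) : Set V)) : Prop) :=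
  (ValidO.coe_F_subset_Fp hV 0).trans (coe_Fp_subset_wireSet hSt h e ha' du (Nat.zero_le _))

include ha' hSt in
/-- Under `μ` the pattern on the explored edges is the recorded one, almost surely. [folklore] -/
theorem ValidO.ae_cyl : ((∀ᵐ ω ∂prodBernoulli (S.Wfull G h e a a' du),
    ω ∈ localCylinder (↑(S.F G h) : Set (Sym2 V)) ↑(S.ξ G h)) : Prop) := by
  have : S.Wfull G h e a a' du = pinW (restrW (↑(S.Sx G h e a a' du) : Set V) (KNLevels.lattW G S.p)) ↑(S.F G h) ↑(S.ξ G h) := by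
    unfold Wfull
    exact restrW_pinW_comm _ _ (ValidO.coe_F_subset_wireSet hV ha' hSt)
  rw [this]
  exact prodBernoulli_pinW_ae_localCylinder _ (S.F G h).finite_toSet.countable _

/-- Under `μ` no non-edge of `G` is open, almost surely. [folklore] -/
theorem ValidO.ae_forall_notMem [Countable V] : ((∀ᵐ ω ∂prodBernoulli (S.Wfull G h e a a' du),
    ∀ x ∈ {x : Sym2 V | x ∉ G.edgeSet}, x ∉ ω) : Prop) := by
  refine prodBernoulli_ae_forall_notMem _ (Set.to_countable _) fun x hx => ?_
  unfold Wfull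
  by_cases hxS : x ∈ wireSet (↑(S.Sx G h e a a' du) : Set V)
  · rw [restrW_apply_of_mem _ hxS, pinW_apply_of_not_mem _ _ (fun hxF => hx (ValidO.mem_edgeSet_of_mem_F hV hxF))]
    rw [KNLevels.lattW_apply, if_neg hx]
  · exact restrW_apply_of_not_mem _ hxS

/-- Under `μ` every `lattOnly D` holds almost surely. [folklore] -/
theorem ValidO.ae_lattOnly [Countable V] (D : Finset V) : ((∀ᵐ ω ∂prodBernoulli (S.Wfull G h e a a' du), ω ∈ KNLevels.lattOnly G D) : Prop) := by
  filter_upwards [ValidO.ae_forall_notMem hV (a := a) (a' := a') (du := du)] with ω hω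
  intro x _ hxω
  by_contra hx
  exact hω x hx hxω

/-! ## §4 The transfer: pinning `μ` on the pairs of level `j` gives the weighting of (30) -/

include ha' hdu hSt in
/-- **Under `μ` pinned on the pairs inside `E_i ∪ E_{w,v} ∪ H^j` along a lattice pattern `T` extending `ω|_{E_i}`, the weighting is that of (30)
at level `j` (fixed departure anchor `a'`) for the observation `T`.** [cite: KozmaNitzan2024, §4 p. 30 (Step III: "usual percolation on this
auxiliary graph is identical to conditioned percolation on Ω")] -/
theorem pinW_Wfull_eq_WtO {j : ℕ} (hj : j < S.Γ.K) {T : Finset (Sym2 V)}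
    (hTc : (↑T : Set (Sym2 V)) ∈ localCylinder (↑(S.F G h) : Set (Sym2 V)) ↑(S.ξ G h))
    (hTl : (↑T : Set (Sym2 V)) ∈ KNLevels.lattOnly G (S.Vx G h ∪ S.Γ.Ewv a e.1 e.2 ∪ S.Γ.Stub a' (tgt e) du j)) :
    pinW (S.Wfull G h e a a' du) ↑(S.Fp G h e a a' du j) ↑T = S.Wt G h e a a' du j (obs ↑T (S.envO G h e a)) := by
  have hFpS := coe_Fp_subset_wireSet (G := G) hSt h e ha' du hj.le
  funext x
  unfold Wt Wfull
  by_cases hxP : x ∈ S.Fp G h e a a' du j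
  · have hxS : x ∈ wireSet (↑(S.Sx G h e a a' du) : Set V) := hFpS (Finset.mem_coe.2 hxP)
    rw [restrW_apply_of_mem _ hxS]
    by_cases hxj : x ∈ S.Fj G h e a a' du j
    · -- an edge of `G` of level `j`: both sides read the pattern
      have hiff : x ∈ (↑(S.pat G h e a a' du j (obs ↑T (S.envO G h e a))) : Set (Sym2 V)) ↔ x ∈ (↑T : Set (Sym2 V)) := by
        rw [Finset.mem_coe, Finset.mem_coe, pat, Finset.mem_union, Finset.mem_inter, mem_obs_iff, Finset.mem_sdiff,
          Finset.mem_coe]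
        by_cases hxF : x ∈ S.F G h
        · have h1 := hTc x (Finset.mem_coe.2 hxF)
          rw [Finset.mem_coe, Finset.mem_coe] at h1
          constructor
          · rintro (h2 | ⟨-, -, h3⟩)
            · exact h1.2 h2
            · exact absurd hxF h3
          · intro h2; exact Or.inl (h1.1 h2)
        · have hxenv : x ∈ S.envO G h e a := S.Fj_sdiff_subset_envO h e a ha' hdu hj (Finset.mem_sdiff.2 ⟨hxj, hxF⟩)
          constructor
          · rintro (h2 | ⟨⟨-, h3⟩, -, -⟩)
            · exact absurd (hV.ξ_sub h2) hxF
            · exact h3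
          · intro h2; exact Or.inr ⟨⟨hxenv, h2⟩, hxj, hxF⟩
      by_cases hxT : x ∈ (↑T : Set (Sym2 V))
      · rw [pinW_apply_of_mem_of_mem _ (Finset.mem_coe.2 hxP) hxT,
          pinW_apply_of_mem_of_mem _ (Finset.mem_coe.2 hxj) (hiff.2 hxT)]
      · rw [pinW_apply_of_mem_of_not_mem _ (Finset.mem_coe.2 hxP) hxT,
          pinW_apply_of_mem_of_not_mem _ (Finset.mem_coe.2 hxj) (fun h' => hxT (hiff.1 h'))]
    · -- a non-edge pair of level `j`: closed on both sides
      have hxE : x ∉ G.edgeSet := by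
        intro hxE
        apply hxj
        rw [Fj, mem_edgesIn_iff]
        refine ⟨hxE, fun y hy => ?_⟩
        have := (Finset.mem_coe.2 hxP : x ∈ (↑(S.Fp G h e a a' du j) : Set (Sym2 V)))
        rw [Fp, KNLevels.coe_pairsF] at this
        exact Finset.mem_coe.1 (this.1 y hy)
      have hxT : x ∉ (↑T : Set (Sym2 V)) := fun hxT => hxE (hTl x hxP hxT)
      rw [pinW_apply_of_mem_of_not_mem _ (Finset.mem_coe.2 hxP) hxT, pinW_apply_of_not_mem _ _ (fun h' => hxj (Finset.mem_coe.1 h')),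
        KNLevels.lattW_apply, if_neg hxE]
  · have hxj : x ∉ (↑(S.Fj G h e a a' du j) : Set (Sym2 V)) := fun h' => hxP (Fj_subset_Fp h e a a' du j (Finset.mem_coe.1 h'))
    have hxF : x ∉ (↑(S.F G h) : Set (Sym2 V)) := fun h' => hxP (Finset.mem_coe.1 (ValidO.coe_F_subset_Fp hV j h'))
    rw [pinW_apply_of_not_mem _ _ (fun h' => hxP (Finset.mem_coe.1 h'))]
    by_cases hxS : x ∈ wireSet (↑(S.Sx G h e a a' du) : Set V)
    · rw [restrW_apply_of_mem _ hxS, restrW_apply_of_mem _ hxS, pinW_apply_of_not_mem _ _ hxF, pinW_apply_of_not_mem _ _ hxj]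
    · rw [restrW_apply_of_not_mem _ hxS, restrW_apply_of_not_mem _ hxS]

end Setting

end KSchA

end KNCells

end Transplant

end Summit.CriticalPhenomena.PercolationContinuityZ3.Theorems

end
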